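import Literature.AlgebraicGeometry.HodgeTheory.CyclicCoverReflectionMonodromy
import HarnessLib

/-!
# The Picard–Lefschetz package of a family of cyclic covers ASSEMBLED from its local monodromies
# (Carlson–Toledo 1999 §3, §7: one orbit and spanning are consequences; linear algebra over `ℚ`)

Family `hodge`, layer `Literature/AlgebraicGeometry/HodgeTheory`; theorems only (no definition, no named fact).
Companion of `CyclicCoverReflectionMonodromy`, whose HYPOTHESIS STRUCTURE `CyclicReflectionSystem Γ B τ p`
bundles, for the monodromy group `Γ` of a point of the universal family of `p`-cyclic covers of the plane,
five printed properties: the vanishing vectors `δ_γ` of the meridians `γ` (non-zero, no `τ`-invariants,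
`dim ℚ[τ]δ_γ = p − 1`, cup form non-degenerate on `ℚ[τ]δ_γ`; §6), the cyclic reflections along them lie in
`Γ` (§6 Proposition) and GENERATE `Γ` (§3), the vanishing spaces form ONE `Γ`-orbit (§3/§7) and SPAN the
`τ`-anti-invariant part (§7 last paragraph).

This file proves that the last two clauses — and the whole structure — FOLLOW from per-meridian data,
exactly as the source derives them (§3: "Writing down a conjugacy `γ' = κ⁻¹γκ` and applying it to
(plformula), one concludes that `δ' = ρ(κ⁻¹)(δ)`. Thus the vanishing cycles constitute a single orbit";
"A cycle orthogonal to `V` is invariant under all Picard-Lefschetz transformations, hence is invariant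
under the action of monodromy. Consequently its orthogonal complement `V^⊥` is the space of invariant
cycles"; §7: "By the same argument as used in §3, one sees that the complex vanishing cycles span `H(i)`").
INPUT (`nonempty_cyclicReflectionSystem_of_meridians`): a set `𝓜 ⊆ Γ` of "meridian monodromies" with
`Γ ≤ closure 𝓜` (Zariski–van Kampen), any two elements of `𝓜` conjugate in `Γ` (meridians of the
irreducible discriminant are conjugate), each `T ∈ 𝓜` the cyclic reflection along some `δ` with the four
§6 properties (the LOCAL Picard–Lefschetz content), and the monodromy invariants contained in the
`τ`-invariants (Deligne's theorem of the fixed part, as used in §3); with `B` symmetric, non-degenerate,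
`τ`-invariant, `τ^p = 1`, `p ≠ 0`, `V` finite-dimensional. OUTPUT: `Nonempty (CyclicReflectionSystem Γ B τ p)`,
with `R` the set of reflection vectors of the elements of `𝓜`.

Two lemmas carry the argument and need NO isometry or commutation hypothesis on `Γ`:
* `range_sub_id_eq_cyclicSpan` — **the vanishing space of a cyclic reflection `T` along `ℚ[τ]δ` is
  `range (T − 1)`** (`τ − 1` is invertible on `ℚ[τ]δ`, which has no `τ`-fixed vector; `T − 1` kills the
  orthogonal complement); hence `range (gTg⁻¹ − 1) = g · range (T − 1)` transports vanishing spaces along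
  conjugacies (`map_cyclicSpan_eq_of_conj`) — the one-orbit clause;
* `mem_iSup_cyclicSpan_of_invariants` — **spanning**: the `B`-orthogonal of `W = Σ_δ ℚ[τ]δ` is fixed by every
  cyclic reflection along the `ℚ[τ]δ`, hence by `closure 𝓜 ⊇ Γ`, hence (hypothesis) by `τ`; `τ`-fixed vectors
  are orthogonal to `ker(1 + τ + ⋯ + τ^{p−1})`, so `ker(…) ⊆ W^⊥⊥ = W`.

Written by the prover seat `hodge-nonav-prover-Bx` (g8) for crux K1 of the route `CyclicUnitaryPowers`
(Hodge summit): it is the algebraic half of the derivation of the cited package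
`carlsonToledo1999_cyclicReflectionSystem` from the local §6 Proposition.

## References

* [CarlsonToledo1999] J. A. Carlson, D. Toledo, Discriminant complements and kernels of monodromy
  representations, Duke Math. J. 97 (1999); arXiv alg-geom/9708002 (held text `paper:arxiv-alg-geom_9708002`),
  §3 (p0006–p0007), §6 Proposition (p0013–p0014), §7 (reflectionconjugacy) and last paragraph (p0015–p0016).
* [DeligneHodgeII1971] P. Deligne, Théorie de Hodge II, Publ. Math. IHÉS 40 (1971), Thm. 4.1.1 (the fixed
  part; enters only as the hypothesis `hinv`).
-/

noncomputable section

namespace Literature.AlgebraicGeometry.HodgeTheory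

section Algebra

variable {V : Type*} [AddCommGroup V] [Module ℚ V]

/-! ### Powers of `τ` on a cyclic span -/

/-- `Σ_{i<p} τ^i` kills every vector of `ℚ[τ]δ` as soon as it kills `δ` (`τ` commutes with the norm
element). [cite: CarlsonToledo1999, §6 (held text p0013)] -/
theorem sum_pow_apply_eq_zero_of_mem_cyclicSpan (τ : V ≃ₗ[ℚ] V) {p : ℕ} {δ : V}
    (hδ : ∑ i ∈ Finset.range p, (τ ^ i) δ = 0) {x : V} (hx : x ∈ cyclicSpan τ δ) :
    ∑ i ∈ Finset.range p, (τ ^ i) x = 0 := by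
  induction hx using Submodule.span_induction with
  | mem y hy =>
    obtain ⟨j, rfl⟩ := hy
    have h : ∀ i ∈ Finset.range p, (τ ^ i) ((τ ^ j) δ) = (τ ^ j) ((τ ^ i) δ) := by
      intro i _
      rw [← LinearEquiv.mul_apply, ← LinearEquiv.mul_apply, ← pow_add, ← pow_add, add_comm]
    rw [Finset.sum_congr rfl h, ← map_sum, hδ, map_zero]
  | zero => simp
  | add y z _ _ hy hz => simp [map_add, Finset.sum_add_distrib, hy, hz]
  | smul c y _ hy => simp [map_smul, ← Finset.smul_sum, hy]

/-- On a `τ`-fixed vector `Σ_{i<p} τ^i` acts as multiplication by `p` (so a vanishing space, killed by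
`Σ_{i<p} τ^i`, has no `τ`-fixed vector: "the eigenvalues are the `k`-th roots of unity `μ ≠ 1`").
[cite: CarlsonToledo1999, §6 (held text p0013)] -/
theorem sum_pow_apply_of_apply_eq_self (τ : V ≃ₗ[ℚ] V) (p : ℕ) {x : V} (hx : τ x = x) :
    ∑ i ∈ Finset.range p, (τ ^ i) x = (p : ℚ) • x := by
  have h' : ∀ i : ℕ, (τ ^ i) x = x := fun i ↦ by
    induction i with
    | zero => rw [pow_zero]; rfl
    | succ i ih => rw [pow_succ, LinearEquiv.mul_apply, hx, ih]
  rw [Finset.sum_congr rfl fun i _ ↦ h' i, Finset.sum_const, Finset.card_range, Nat.cast_smul_eq_nsmul]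

/-- A `τ`-fixed vector of `ℚ[τ]δ` is zero when `ℚ[τ]δ` has no `τ`-invariants (`Σ_{i<p} τ^i δ = 0`, `p ≠ 0`):
"the eigenvalues are the `k`-th roots of unity `μ ≠ 1`". [cite: CarlsonToledo1999, §6 (held text p0013)] -/
theorem eq_zero_of_mem_cyclicSpan_of_apply_eq_self (τ : V ≃ₗ[ℚ] V) {p : ℕ} (hp0 : p ≠ 0) {δ : V}
    (hδ : ∑ i ∈ Finset.range p, (τ ^ i) δ = 0) {x : V} (hx : x ∈ cyclicSpan τ δ) (hτx : τ x = x) :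
    x = 0 := by
  have h := sum_pow_apply_of_apply_eq_self τ p hτx
  rw [sum_pow_apply_eq_zero_of_mem_cyclicSpan τ hδ hx] at h
  exact (smul_eq_zero.mp h.symm).resolve_left (Nat.cast_ne_zero.mpr hp0)

/-- `τ`-invariant vectors are `B`-orthogonal to the `τ`-anti-invariant part `ker(Σ_{i<p} τ^i)` when `B` is
`τ`-invariant and `p ≠ 0` (`p·B(u,v) = B(u, Σ τ^i v) = 0`): the hyperplane class is orthogonal to
`H²_0 = ⊕_{μ ≠ 1} H(μ)`. [cite: CarlsonToledo1999, §2 (held text p0005) and §3 (held text p0006)] -/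
theorem apply_eq_zero_of_apply_eq_self_of_sum_pow_apply_eq_zero {B : LinearMap.BilinForm ℚ V}
    {τ : V ≃ₗ[ℚ] V} (hBτ : ∀ x y, B (τ x) (τ y) = B x y) {p : ℕ} (hp0 : p ≠ 0) {u v : V} (hu : τ u = u)
    (hv : ∑ i ∈ Finset.range p, (τ ^ i) v = 0) : B u v = 0 := by
  have hui : ∀ i : ℕ, (τ ^ i) u = u := fun i ↦ by
    induction i with
    | zero => rw [pow_zero]; rfl
    | succ i ih => rw [pow_succ, LinearEquiv.mul_apply, hu, ih]
  have hiso : ∀ (i : ℕ) (x y : V), B ((τ ^ i) x) ((τ ^ i) y) = B x y := fun i ↦ by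
    induction i with
    | zero => intro x y; rw [pow_zero]; rfl
    | succ i ih => intro x y; rw [pow_succ', LinearEquiv.mul_apply, LinearEquiv.mul_apply, hBτ, ih]
  have hi : ∀ i ∈ Finset.range p, B u ((τ ^ i) v) = B u v := by
    intro i _
    conv_lhs => rw [← hui i]
    exact hiso i u v
  have h : (p : ℚ) * B u v = B u (∑ i ∈ Finset.range p, (τ ^ i) v) := by
    rw [map_sum, Finset.sum_congr rfl hi, Finset.sum_const, Finset.card_range, nsmul_eq_mul]
  rw [hv, map_zero] at h
  exact (mul_eq_zero.mp h).resolve_left (Nat.cast_ne_zero.mpr hp0)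

/-! ### The vanishing space of a cyclic reflection is the image of `T − 1` -/

section Reflection

variable {B : LinearMap.BilinForm ℚ V} {τ : V ≃ₗ[ℚ] V} {p : ℕ} {δ : V} {T : V ≃ₗ[ℚ] V}

/-- If `B` is symmetric and non-degenerate on `ℚ[τ]δ`, then `V = ℚ[τ]δ ⊕ (ℚ[τ]δ)^⊥` ("`H^{n+1}(Y_õ)` splits
orthogonally as `V ⊕ V^⊥`"). [cite: CarlsonToledo1999, §6 (held text p0014)] -/
theorem isCompl_cyclicSpan_orthogonal [Module.Finite ℚ V] (hB : B.IsSymm)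
    (hnd : ∀ x ∈ cyclicSpan τ δ, (∀ y ∈ cyclicSpan τ δ, B x y = 0) → x = 0) :
    IsCompl (cyclicSpan τ δ) (B.orthogonal (cyclicSpan τ δ)) := by
  have hBsymm : ∀ u v : V, B u v = B v u := fun u v ↦ by simpa using hB.eq u v
  have hnd' : (B.restrict (cyclicSpan τ δ)).Nondegenerate := by
    refine (LinearMap.IsRefl.nondegenerate_iff_separatingLeft fun a b hab ↦ ?_).mpr ?_
    · change B b.1 a.1 = 0
      rw [hBsymm]
      exact hab
    · intro a ha
      exact Subtype.ext (hnd a.1 a.2 fun y hy ↦ ha ⟨y, hy⟩)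
  exact LinearMap.BilinForm.isCompl_orthogonal_of_restrict_nondegenerate hB.isRefl hnd'

/-- **The vanishing space of a cyclic reflection is `range (T − 1)`.** If `T` is the cyclic reflection along
`ℚ[τ]δ` (`T = τ` there, `T = id` on the `B`-orthogonal), `ℚ[τ]δ` has no `τ`-invariants (`Σ_{i<p} τ^i δ = 0`,
`p ≠ 0`), `B` is symmetric and non-degenerate on `ℚ[τ]δ`, and `V` is finite-dimensional, then
`{T x − x} = ℚ[τ]δ`: the difference `T − 1` vanishes on the orthogonal complement and restricts to the
invertible `τ − 1` on `ℚ[τ]δ`. This identifies the vanishing space of a meridian from its monodromy alone.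
[cite: CarlsonToledo1999, §6 Proposition and (Tcxreflectionformula) (held text p0014)] -/
theorem range_sub_id_eq_cyclicSpan [Module.Finite ℚ V] (hB : B.IsSymm) (hp0 : p ≠ 0)
    (hδ : ∑ i ∈ Finset.range p, (τ ^ i) δ = 0)
    (hnd : ∀ x ∈ cyclicSpan τ δ, (∀ y ∈ cyclicSpan τ δ, B x y = 0) → x = 0)
    (hT : IsCyclicReflection B τ δ T) :
    LinearMap.range ((T : V →ₗ[ℚ] V) - LinearMap.id) = cyclicSpan τ δ := by
  have hBsymm : ∀ u v : V, B u v = B v u := fun u v ↦ by simpa using hB.eq u v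
  have hcompl := isCompl_cyclicSpan_orthogonal (τ := τ) (δ := δ) hB hnd
  apply le_antisymm
  · rintro _ ⟨x, rfl⟩
    obtain ⟨a, ha, b, hb, rfl⟩ := Submodule.mem_sup.mp
      (show x ∈ cyclicSpan τ δ ⊔ B.orthogonal (cyclicSpan τ δ) by rw [hcompl.sup_eq_top]; trivial)
    rw [LinearMap.BilinForm.mem_orthogonal_iff] at hb
    have hb' : ∀ y ∈ cyclicSpan τ δ, B b y = 0 := fun y hy ↦ by rw [hBsymm]; exact hb y hy
    have hTa : T a = τ a := hT.1 a ha
    have hTb : T b = b := hT.2 b hb'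
    rw [LinearMap.sub_apply, LinearMap.id_apply, LinearEquiv.coe_coe, map_add, hTa, hTb]
    have h : τ a + b - (a + b) = τ a - a := by abel
    rw [h]
    exact Submodule.sub_mem _ (apply_mem_cyclicSpan τ δ ha) ha
  · intro y hy
    -- `τ - 1` restricted to the finite-dimensional `ℚ[τ]δ` is injective, hence surjective
    set f : V →ₗ[ℚ] V := (τ : V →ₗ[ℚ] V) - LinearMap.id with hf
    have hfw : ∀ w : V, f w = τ w - w := fun w ↦ by
      rw [hf, LinearMap.sub_apply, LinearMap.id_apply, LinearEquiv.coe_coe]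
    have hWτ : ∀ w ∈ cyclicSpan τ δ, f w ∈ cyclicSpan τ δ := fun w hw ↦ by
      rw [hfw]
      exact Submodule.sub_mem _ (apply_mem_cyclicSpan τ δ hw) hw
    let φ : cyclicSpan τ δ →ₗ[ℚ] cyclicSpan τ δ := f.restrict hWτ
    have hφ : ∀ w : cyclicSpan τ δ, (φ w : V) = τ w.1 - w.1 := fun w ↦ by
      rw [← hfw]
      rfl
    have hinj : Function.Injective φ := by
      rw [← LinearMap.ker_eq_bot, LinearMap.ker_eq_bot']
      intro w hw
      have hw' : τ w.1 - w.1 = 0 := by rw [← hφ w, hw]; rfl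
      have hτw : τ w.1 = w.1 := sub_eq_zero.mp hw'
      exact Subtype.ext (eq_zero_of_mem_cyclicSpan_of_apply_eq_self τ hp0 hδ w.2 hτw)
    have hsurj : Function.Surjective φ := LinearMap.surjective_of_injective hinj
    obtain ⟨a, ha⟩ := hsurj ⟨y, hy⟩
    have ha' : τ a.1 - a.1 = y := by rw [← hφ a, ha]
    refine ⟨a.1, ?_⟩
    rw [LinearMap.sub_apply, LinearMap.id_apply, LinearEquiv.coe_coe, hT.1 a.1 a.2, ha']

/-- **Vanishing spaces move along conjugacies**: if `T` is the cyclic reflection along `ℚ[τ]δ` and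
`T' = g T g⁻¹` is the cyclic reflection along `ℚ[τ]δ'` (both vanishing spaces non-degenerate and without
`τ`-invariants), then `g · ℚ[τ]δ = ℚ[τ]δ'` ("`γ' = κ⁻¹γκ` […] `δ' = κ⁻¹.δ`"; no hypothesis on `g`).
[cite: CarlsonToledo1999, §3 (held text p0007) and §7 last paragraph (held text p0016)] -/
theorem map_cyclicSpan_eq_of_conj [Module.Finite ℚ V] (hB : B.IsSymm) (hp0 : p ≠ 0)
    (hδ : ∑ i ∈ Finset.range p, (τ ^ i) δ = 0)
    (hnd : ∀ x ∈ cyclicSpan τ δ, (∀ y ∈ cyclicSpan τ δ, B x y = 0) → x = 0)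
    (hT : IsCyclicReflection B τ δ T) {δ' : V} {T' : V ≃ₗ[ℚ] V}
    (hδ' : ∑ i ∈ Finset.range p, (τ ^ i) δ' = 0)
    (hnd' : ∀ x ∈ cyclicSpan τ δ', (∀ y ∈ cyclicSpan τ δ', B x y = 0) → x = 0)
    (hT' : IsCyclicReflection B τ δ' T') {g : V ≃ₗ[ℚ] V} (hconj : T' = g * T * g⁻¹) :
    (cyclicSpan τ δ).map (g : V →ₗ[ℚ] V) = cyclicSpan τ δ' := by
  have hcomp : ((T' : V →ₗ[ℚ] V) - LinearMap.id) =
      ((g : V →ₗ[ℚ] V).comp ((T : V →ₗ[ℚ] V) - LinearMap.id)).comp ((g⁻¹ : V ≃ₗ[ℚ] V) : V →ₗ[ℚ] V) := by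
    ext x
    simp only [LinearMap.sub_apply, LinearMap.id_apply, LinearEquiv.coe_coe, LinearMap.comp_apply, map_sub]
    rw [hconj, LinearEquiv.mul_apply, LinearEquiv.mul_apply]
    congr 1
    rw [LinearEquiv.coe_inv, LinearEquiv.apply_symm_apply]
  rw [← range_sub_id_eq_cyclicSpan hB hp0 hδ hnd hT, ← range_sub_id_eq_cyclicSpan hB hp0 hδ' hnd' hT', hcomp,
    LinearMap.range_comp_of_range_eq_top _ (LinearEquiv.range _), LinearMap.range_comp]

end Reflection

/-! ### Spanning from the theorem of the fixed part -/

/-- **Spanning.** Let `𝓡 ⊆ V` be a set of vectors such that the cyclic reflections along the `ℚ[τ]δ`,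
`δ ∈ 𝓡`, generate a group containing the subgroup `Δ`, and suppose every `Δ`-invariant vector is
`τ`-invariant (the monodromy
invariants are pull-backs from `ℙ²`, Deligne's theorem of the fixed part as used in CT99 §3). If `B` is
symmetric, non-degenerate, `τ`-invariant and `p ≠ 0`, then every `τ`-anti-invariant vector lies in
`Σ_{δ ∈ 𝓡} ℚ[τ]δ`: "A cycle orthogonal to `V` is invariant under all Picard-Lefschetz transformations, hence
[…] under the action of monodromy […] `V^⊥` is the space of invariant cycles", and invariant cycles are
orthogonal to the anti-invariant part. [cite: CarlsonToledo1999, §3 (held text p0006) and §7 last paragraph (held text p0016)] -/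
theorem mem_iSup_cyclicSpan_of_invariants [Module.Finite ℚ V] {B : LinearMap.BilinForm ℚ V}
    {τ : V ≃ₗ[ℚ] V} {p : ℕ} (hB : B.IsSymm) (hBnd : B.Nondegenerate)
    (hBτ : ∀ x y, B (τ x) (τ y) = B x y) (hp0 : p ≠ 0) {Δ : Subgroup (V ≃ₗ[ℚ] V)} {𝓡 : Set V}
    (hgen : Δ ≤ Subgroup.closure {r | ∃ δ ∈ 𝓡, IsCyclicReflection B τ δ r})
    (hinv : ∀ x : V, (∀ g ∈ Δ, g x = x) → τ x = x)
    (x : V) (hx : ∑ i ∈ Finset.range p, (τ ^ i) x = 0) :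
    x ∈ ⨆ δ ∈ 𝓡, cyclicSpan τ δ := by
  have hBsymm : ∀ u v : V, B u v = B v u := fun u v ↦ by simpa using hB.eq u v
  set W : Submodule ℚ V := ⨆ δ ∈ 𝓡, cyclicSpan τ δ with hW
  -- Step 1: `W^⊥` is fixed by every cyclic reflection along the `ℚ[τ]δ`, hence by `Δ`, hence by `τ`.
  have hfix : ∀ y ∈ B.orthogonal W, τ y = y := by
    intro y hy
    rw [LinearMap.BilinForm.mem_orthogonal_iff] at hy
    have hy' : ∀ δ ∈ 𝓡, ∀ z ∈ cyclicSpan τ δ, B y z = 0 := fun δ hδ z hz ↦ by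
      rw [hBsymm]
      exact hy z (Submodule.mem_iSup_of_mem δ (Submodule.mem_iSup_of_mem hδ hz))
    have key : ∀ r ∈ Subgroup.closure {r | ∃ δ ∈ 𝓡, IsCyclicReflection B τ δ r}, r y = y := by
      intro r hr
      induction hr using Subgroup.closure_induction with
      | mem r hr =>
        obtain ⟨δ, hδ, hr⟩ := hr
        exact hr.2 y (hy' δ hδ)
      | one => rfl
      | mul r r' _ _ hr hr' => rw [LinearEquiv.mul_apply, hr', hr]
      | inv r _ hr =>
        have h : r⁻¹ (r y) = y := by rw [← LinearEquiv.mul_apply, inv_mul_cancel]; rfl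
        rw [hr] at h
        exact h
    exact hinv y fun g hg ↦ key g (hgen hg)
  -- Step 2: `x` is orthogonal to `W^⊥` (anti-invariant ⊥ invariant), so `x ∈ W^⊥⊥ = W`.
  have hxWW : x ∈ B.orthogonal (B.orthogonal W) := by
    rw [LinearMap.BilinForm.mem_orthogonal_iff]
    intro y hy
    exact apply_eq_zero_of_apply_eq_self_of_sum_pow_apply_eq_zero hBτ hp0 (hfix y hy) hx
  rwa [LinearMap.BilinForm.orthogonal_orthogonal hBnd hB.isRefl] at hxWW

/-! ### The package from the local monodromies -/

/-- **The Picard–Lefschetz package of a family of cyclic covers from its local monodromies** (CT99 §3/§7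
derivation of "one orbit" and "spanning"). Data at a base point: the monodromy group `Γ`; a set
`𝓜 ⊆ Γ` — the monodromies of the meridians of the discriminant — with `Γ ≤ closure 𝓜` (`π₁` of the
complement is generated by meridians, §3) and any two elements of `𝓜` conjugate in `Γ` (meridians of the
irreducible discriminant are conjugate, §3/§7); each `T ∈ 𝓜` is the cyclic reflection along the vanishing
space `ℚ[τ]δ` of some `δ ≠ 0` with `Σ_{i<p} τ^i δ = 0`, `dim ℚ[τ]δ = p − 1` and `B` non-degenerate on it
(§6 Proposition); and the `Γ`-invariants are `τ`-invariant (§3 with Deligne 4.1.1). Then, for `B` symmetric,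
non-degenerate and `τ`-invariant, `p ≠ 0` (`τ^p = 1` is not even used) and `V` finite-dimensional,
`CyclicReflectionSystem Γ B τ p` holds with `R` the set of reflection vectors of the elements of `𝓜`.
[cite: CarlsonToledo1999, §3, §6 Proposition, §7 last paragraph (held text p0006–p0007, p0013–p0016)] -/
theorem nonempty_cyclicReflectionSystem_of_meridians [Module.Finite ℚ V] {B : LinearMap.BilinForm ℚ V}
    {τ : V ≃ₗ[ℚ] V} {p : ℕ} (hB : B.IsSymm) (hBnd : B.Nondegenerate)
    (hBτ : ∀ x y, B (τ x) (τ y) = B x y) (hp0 : p ≠ 0)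
    {Γ : Subgroup (V ≃ₗ[ℚ] V)} {𝓜 : Set (V ≃ₗ[ℚ] V)} (h𝓜 : 𝓜 ⊆ Γ)
    (hgen : Γ ≤ Subgroup.closure 𝓜)
    (hconj : ∀ T ∈ 𝓜, ∀ T' ∈ 𝓜, ∃ g ∈ Γ, T' = g * T * g⁻¹)
    (hloc : ∀ T ∈ 𝓜, ∃ δ : V, δ ≠ 0 ∧ (∑ i ∈ Finset.range p, (τ ^ i) δ) = 0 ∧
      Module.finrank ℚ (cyclicSpan τ δ) = p - 1 ∧
      (∀ x ∈ cyclicSpan τ δ, (∀ y ∈ cyclicSpan τ δ, B x y = 0) → x = 0) ∧ IsCyclicReflection B τ δ T)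
    (hinv : ∀ x : V, (∀ g ∈ Γ, g x = x) → τ x = x) :
    Nonempty (CyclicReflectionSystem Γ B τ p) := by
  classical
  -- the reflection vectors of the meridian monodromies
  let R : Set V := {δ | ∃ T ∈ 𝓜, δ ≠ 0 ∧ (∑ i ∈ Finset.range p, (τ ^ i) δ) = 0 ∧
      Module.finrank ℚ (cyclicSpan τ δ) = p - 1 ∧
      (∀ x ∈ cyclicSpan τ δ, (∀ y ∈ cyclicSpan τ δ, B x y = 0) → x = 0) ∧ IsCyclicReflection B τ δ T}
  have h𝓜R : 𝓜 ⊆ {r | ∃ δ ∈ R, IsCyclicReflection B τ δ r} := by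
    intro T hT
    obtain ⟨δ, h0, hΦ, hdim, hnd, hrefl⟩ := hloc T hT
    exact ⟨δ, ⟨T, hT, h0, hΦ, hdim, hnd, hrefl⟩, hrefl⟩
  refine ⟨⟨R, ?_, ?_, ?_, ?_, ?_, hgen.trans (Subgroup.closure_mono h𝓜R), ?_, ?_⟩⟩
  · rintro δ ⟨T, -, h0, -⟩
    exact h0
  · rintro δ ⟨T, -, -, hΦ, -⟩
    exact hΦ
  · rintro δ ⟨T, -, -, -, hdim, -⟩
    exact hdim
  · rintro δ ⟨T, -, -, -, -, hnd, -⟩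
    exact hnd
  · rintro δ ⟨T, hT, -, -, -, -, hrefl⟩
    exact ⟨T, h𝓜 hT, hrefl⟩
  · -- one orbit: `ℚ[τ]δ' = range(T' − 1) = g · range(T − 1) = g · ℚ[τ]δ`
    rintro δ ⟨T, hT, -, hΦ, -, hnd, hrefl⟩ δ' ⟨T', hT', -, hΦ', -, hnd', hrefl'⟩
    obtain ⟨g, hg, hgc⟩ := hconj T' hT' T hT
    exact ⟨g, hg, map_cyclicSpan_eq_of_conj hB hp0 hΦ' hnd' hrefl' hΦ hnd hrefl hgc⟩
  · -- spanning
    intro x hx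
    exact mem_iSup_cyclicSpan_of_invariants hB hBnd hBτ hp0 (Δ := Γ) (𝓡 := R)
      (hgen.trans (Subgroup.closure_mono h𝓜R)) hinv x hx

/-! ### Convention-free forms: meridian monodromies up to inversion -/

section UpToInverse

variable {B : LinearMap.BilinForm ℚ V} {τ : V ≃ₗ[ℚ] V} {p : ℕ} {δ : V} {T : V ≃ₗ[ℚ] V}

/-- `range (T⁻¹ − 1) = range (T − 1)`: `T⁻¹ − 1 = −T⁻¹ ∘ (T − 1)`, so the vanishing space read off a
local monodromy does not depend on the orientation of the meridian.
[cite: CarlsonToledo1999, §6 (held text p0014)] -/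
theorem range_inv_sub_id_eq (T : V ≃ₗ[ℚ] V) :
    LinearMap.range (((T⁻¹ : V ≃ₗ[ℚ] V) : V →ₗ[ℚ] V) - LinearMap.id) =
      LinearMap.range ((T : V →ₗ[ℚ] V) - LinearMap.id) := by
  apply le_antisymm
  · rintro _ ⟨x, rfl⟩
    refine ⟨-((T⁻¹ : V ≃ₗ[ℚ] V) x), ?_⟩
    simp only [LinearMap.sub_apply, LinearMap.id_apply, LinearEquiv.coe_coe, map_neg, LinearEquiv.coe_inv,
      LinearEquiv.apply_symm_apply]
    abel
  · rintro _ ⟨x, rfl⟩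
    refine ⟨-(T x), ?_⟩
    simp only [LinearMap.sub_apply, LinearMap.id_apply, LinearEquiv.coe_coe, map_neg, LinearEquiv.coe_inv,
      LinearEquiv.symm_apply_apply]
    abel

/-- **Vanishing spaces move along conjugacies, up to inversion**: as `map_cyclicSpan_eq_of_conj`, when
`T'` is conjugate to `T` OR to `T⁻¹` (meridians of opposite orientation have inverse monodromies with the
same vanishing space). [cite: CarlsonToledo1999, §3 (held text p0007) and §7 last paragraph (held text p0016)] -/
theorem map_cyclicSpan_eq_of_conj_or_inv [Module.Finite ℚ V] (hB : B.IsSymm) (hp0 : p ≠ 0)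
    (hδ : ∑ i ∈ Finset.range p, (τ ^ i) δ = 0)
    (hnd : ∀ x ∈ cyclicSpan τ δ, (∀ y ∈ cyclicSpan τ δ, B x y = 0) → x = 0)
    (hT : IsCyclicReflection B τ δ T) {δ' : V} {T' : V ≃ₗ[ℚ] V}
    (hδ' : ∑ i ∈ Finset.range p, (τ ^ i) δ' = 0)
    (hnd' : ∀ x ∈ cyclicSpan τ δ', (∀ y ∈ cyclicSpan τ δ', B x y = 0) → x = 0)
    (hT' : IsCyclicReflection B τ δ' T') {g : V ≃ₗ[ℚ] V}
    (hconj : T' = g * T * g⁻¹ ∨ T' = g * T⁻¹ * g⁻¹) :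
    (cyclicSpan τ δ).map (g : V →ₗ[ℚ] V) = cyclicSpan τ δ' := by
  rcases hconj with hconj | hconj
  · exact map_cyclicSpan_eq_of_conj hB hp0 hδ hnd hT hδ' hnd' hT' hconj
  · have hcomp : ((T' : V →ₗ[ℚ] V) - LinearMap.id) =
        ((g : V →ₗ[ℚ] V).comp (((T⁻¹ : V ≃ₗ[ℚ] V) : V →ₗ[ℚ] V) - LinearMap.id)).comp
          ((g⁻¹ : V ≃ₗ[ℚ] V) : V →ₗ[ℚ] V) := by
      ext x
      simp only [LinearMap.sub_apply, LinearMap.id_apply, LinearEquiv.coe_coe, LinearMap.comp_apply, map_sub]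
      rw [hconj, LinearEquiv.mul_apply, LinearEquiv.mul_apply]
      congr 1
      rw [LinearEquiv.coe_inv g, LinearEquiv.apply_symm_apply]
    rw [← range_sub_id_eq_cyclicSpan hB hp0 hδ hnd hT, ← range_sub_id_eq_cyclicSpan hB hp0 hδ' hnd' hT', hcomp,
      LinearMap.range_comp_of_range_eq_top _ (LinearEquiv.range _), LinearMap.range_comp, range_inv_sub_id_eq]

end UpToInverse

/-- **The package from the local monodromies, convention-free form.** As
`nonempty_cyclicReflectionSystem_of_meridians`, but any two elements of `𝓜` need only be conjugate in `Γ`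
UP TO INVERSION (`T' = gTg⁻¹` or `T' = gT⁻¹g⁻¹`): this is the form supplied by a local Picard–Lefschetz
statement which identifies the monodromy `T` of a meridian OR ITS INVERSE as the cyclic reflection (the
choice depending on orientation conventions), the meridian loops themselves being conjugate.
[cite: CarlsonToledo1999, §3, §6 Proposition, §7 last paragraph (held text p0006–p0007, p0013–p0016)] -/
theorem nonempty_cyclicReflectionSystem_of_meridians' [Module.Finite ℚ V] {B : LinearMap.BilinForm ℚ V}
    {τ : V ≃ₗ[ℚ] V} {p : ℕ} (hB : B.IsSymm) (hBnd : B.Nondegenerate)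
    (hBτ : ∀ x y, B (τ x) (τ y) = B x y) (hp0 : p ≠ 0)
    {Γ : Subgroup (V ≃ₗ[ℚ] V)} {𝓜 : Set (V ≃ₗ[ℚ] V)} (h𝓜 : 𝓜 ⊆ Γ)
    (hgen : Γ ≤ Subgroup.closure 𝓜)
    (hconj : ∀ T ∈ 𝓜, ∀ T' ∈ 𝓜, ∃ g ∈ Γ, T' = g * T * g⁻¹ ∨ T' = g * T⁻¹ * g⁻¹)
    (hloc : ∀ T ∈ 𝓜, ∃ δ : V, δ ≠ 0 ∧ (∑ i ∈ Finset.range p, (τ ^ i) δ) = 0 ∧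
      Module.finrank ℚ (cyclicSpan τ δ) = p - 1 ∧
      (∀ x ∈ cyclicSpan τ δ, (∀ y ∈ cyclicSpan τ δ, B x y = 0) → x = 0) ∧ IsCyclicReflection B τ δ T)
    (hinv : ∀ x : V, (∀ g ∈ Γ, g x = x) → τ x = x) :
    Nonempty (CyclicReflectionSystem Γ B τ p) := by
  classical
  let R : Set V := {δ | ∃ T ∈ 𝓜, δ ≠ 0 ∧ (∑ i ∈ Finset.range p, (τ ^ i) δ) = 0 ∧
      Module.finrank ℚ (cyclicSpan τ δ) = p - 1 ∧
      (∀ x ∈ cyclicSpan τ δ, (∀ y ∈ cyclicSpan τ δ, B x y = 0) → x = 0) ∧ IsCyclicReflection B τ δ T}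
  have h𝓜R : 𝓜 ⊆ {r | ∃ δ ∈ R, IsCyclicReflection B τ δ r} := by
    intro T hT
    obtain ⟨δ, h0, hΦ, hdim, hnd, hrefl⟩ := hloc T hT
    exact ⟨δ, ⟨T, hT, h0, hΦ, hdim, hnd, hrefl⟩, hrefl⟩
  refine ⟨⟨R, ?_, ?_, ?_, ?_, ?_, hgen.trans (Subgroup.closure_mono h𝓜R), ?_, ?_⟩⟩
  · rintro δ ⟨T, -, h0, -⟩
    exact h0
  · rintro δ ⟨T, -, -, hΦ, -⟩
    exact hΦ
  · rintro δ ⟨T, -, -, -, hdim, -⟩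
    exact hdim
  · rintro δ ⟨T, -, -, -, -, hnd, -⟩
    exact hnd
  · rintro δ ⟨T, hT, -, -, -, -, hrefl⟩
    exact ⟨T, h𝓜 hT, hrefl⟩
  · rintro δ ⟨T, hT, -, hΦ, -, hnd, hrefl⟩ δ' ⟨T', hT', -, hΦ', -, hnd', hrefl'⟩
    obtain ⟨g, hg, hgc⟩ := hconj T' hT' T hT
    exact ⟨g, hg, map_cyclicSpan_eq_of_conj_or_inv hB hp0 hΦ' hnd' hrefl' hΦ hnd hrefl hgc⟩
  · intro x hx
    exact mem_iSup_cyclicSpan_of_invariants hB hBnd hBτ hp0 (Δ := Γ) (𝓡 := R)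
      (hgen.trans (Subgroup.closure_mono h𝓜R)) hinv x hx

end Algebra

end Literature.AlgebraicGeometry.HodgeTheory

end
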